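import Literature.Probability.LatticeModels.SingleSignCrossing
import Literature.Probability.LatticeModels.GoodAboveFromPinning
import HarnessLib

/-!
# Good paths of upper type in the single-sign case (GH2000 Lemma 5.5, Cases 1 and 2)

Topic `Probability/LatticeModels`; theorems only. Georgii–Higuchi, J. Math. Phys. 41 (2000), proof of
Lemma 5.5, Case 1 ("`μ(E⁺_up) = 1`, `μ(E⁻_up) = 0`"): "By the pinning lemma and the positive
correlations of `μ`, with probability at least `(θ/4)²` both `x` and `y` are `+∗`connected off `Δ`
to `I^{+∗}_up(ω̂)` in the second layer, whence `x` and `y` are connected by a `+∗`path in `ω̂` off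
`Δ`, which is trivially a `≤∗`path"; Case 2 is the same with `-` paths in the first layer.

In the winding rendition of `NoBadPercolationW`/`GoodAboveFromPinning`: the two pinned walks
(`PinLeft m x`, `PinRightPlus m y` in the layer `ω̂`) end in the unique infinite `∗`-component of
`S⁺(ω̂) ∩ (π_up ∖ Λ_m)` (uniqueness: `ae_singleSign_structure`) and are joined inside it; by
`Percolation.upperType_append` the resulting `+∗`walk of `ω̂` is of upper type, and its sites are
good. The probability bound is positive correlations in the single layer `ω̂`.

* `exists_goodAboveW_of_pins_plus` — deterministic, Case 1 (layer `ω̂`);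
* `exists_goodAboveW_of_pins_minus` — deterministic, Case 2 (layer `ω`);
* `le_measureReal_goodAboveW_of_pins_plus` / `_minus` — for `H` large,
  `μ₂(PinLeft)·μ₂(PinRightPlus) - ε ≤ (μ₁ ⊗ μ₂)(A_{x,y})`, resp. with `μ₁` and `-`pins.

## References

* H.-O. Georgii, Y. Higuchi, J. Math. Phys. 41 (2000) 1153–1169, Lemma 5.5, proof, Cases 1–2 (p. 15)
  [GeorgiiHiguchi2000].
-/

noncomputable section

open MeasureTheory Filter SimpleGraph Topology
open Literature.Probability.Percolation
open scoped ENNReal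

namespace Literature.Probability.LatticeModels

/-! ### The deterministic step -/

section Det

variable {m : ℕ}

/-- **`PinLeft` unfolded**: a `+∗`walk off `Λ_m` from `x` to a site whose `+∗`cluster in
`S⁺ ∩ (π_up ∖ Λ_m)` is infinite, with axis sites left of `-m`. [cite: GeorgiiHiguchi2000, Lemma 5.2] -/
theorem pinLeft_spec {x : Site 2} {ω : SpinConfig (Site 2)} (h : PinLeft m x ω) :
    ∃ a : Site 2, (siteCluster zdStarGraph (spinSites 1 ω ∩ (halfPlane 0 \ ↑(box 2 m))) a).Infinite ∧
      ∃ W : zdStarGraph.Walk x a, ∀ z ∈ W.support, ω z = 1 ∧ z ∉ box 2 m ∧ (z 1 = 0 → z 0 < -(m : ℤ)) := by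
  obtain ⟨a, ha, W, hW⟩ := h
  exact ⟨a, ha.mono (siteCluster_mono (pinU_subset ω) a), W, hW⟩

/-- **Case 1, deterministic**: two `+∗`pinnings in the layer `ω̂` and uniqueness of the infinite
`∗`-component of `S⁺(ω̂) ∩ (π_up ∖ Λ_m)` give a good walk of upper type. [cite: GeorgiiHiguchi2000, Lemma 5.5 (proof, Case 1)] -/
theorem exists_goodAboveW_of_pins_plus (hm : 1 ≤ m) {x y : Site 2} (hy1 : y 1 = 0)
    {p : SpinConfig (Site 2) × SpinConfig (Site 2)}
    (huq : ∀ x₁ x₂, (siteCluster zdStarGraph (spinSites 1 p.2 ∩ (halfPlane 0 \ ↑(box 2 m))) x₁).Infinite →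
      (siteCluster zdStarGraph (spinSites 1 p.2 ∩ (halfPlane 0 \ ↑(box 2 m))) x₂).Infinite →
        x₂ ∈ siteCluster zdStarGraph (spinSites 1 p.2 ∩ (halfPlane 0 \ ↑(box 2 m))) x₁)
    (hL : PinLeft m x p.2) (hR : PinRightPlus m y p.2) : ∃ H, GoodAboveW m H x y p := by
  classical
  obtain ⟨a, ha, Wx, hWx⟩ := pinLeft_spec hL
  obtain ⟨b, hb, Wy, hWy⟩ := pinRightPlus_spec hR
  have haself : a ∈ siteCluster zdStarGraph (spinSites 1 p.2 ∩ (halfPlane 0 \ ↑(box 2 m))) a :=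
    (mem_siteCluster_self_iff _ _ _).2 ha.nonempty.some_mem.1
  obtain ⟨q, hq⟩ := exists_walk_of_mem_siteCluster haself (huq a b ha hb)
  set α := Wx.append (q.append Wy.reverse) with hα
  obtain ⟨H, hH⟩ := exists_box_of_list α.support
  have hU : UpperType m α :=
    upperType_append hm Wx q Wy (fun z hz => (hWx z hz).2)
      (fun z hz => ⟨(hq z hz).2.1, fun h => (hq z hz).2.2 (Finset.mem_coe.2 h)⟩) (fun z hz => (hWy z hz).2) hy1
  refine ⟨H, α, hU, fun z hz => ⟨?_, hH z hz⟩⟩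
  have hz1 : p.2 z = 1 := by
    rw [hα, Walk.mem_support_append_iff, Walk.mem_support_append_iff, Walk.support_reverse, List.mem_reverse] at hz
    rcases hz with hz | hz | hz
    · exact (hWx z hz).1
    · exact (hq z hz).1
    · exact (hWy z hz).1
  rw [mem_spinSites_badConfig]
  rintro ⟨-, h2⟩
  rw [hz1] at h2
  exact absurd h2 (by decide)

/-- **Case 2, deterministic**: two `-∗`pinnings in the layer `ω` and uniqueness of the infinite
`∗`-component of `S⁻(ω) ∩ (π_up ∖ Λ_m)` give a good walk of upper type. [cite: GeorgiiHiguchi2000, Lemma 5.5 (proof, Case 2)] -/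
theorem exists_goodAboveW_of_pins_minus (hm : 1 ≤ m) {x y : Site 2} (hy1 : y 1 = 0)
    {p : SpinConfig (Site 2) × SpinConfig (Site 2)}
    (huq : ∀ x₁ x₂, (siteCluster zdStarGraph (spinSites (-1) p.1 ∩ (halfPlane 0 \ ↑(box 2 m))) x₁).Infinite →
      (siteCluster zdStarGraph (spinSites (-1) p.1 ∩ (halfPlane 0 \ ↑(box 2 m))) x₂).Infinite →
        x₂ ∈ siteCluster zdStarGraph (spinSites (-1) p.1 ∩ (halfPlane 0 \ ↑(box 2 m))) x₁)
    (hL : PinLeft m x (-p.1)) (hR : PinRightMinus m y p.1) : ∃ H, GoodAboveW m H x y p := by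
  classical
  obtain ⟨a, ha, Wx, hWx⟩ := pinLeft_neg_spec hL
  obtain ⟨b, hb, Wy, hWy⟩ := pinRightMinus_spec hR
  have haself : a ∈ siteCluster zdStarGraph (spinSites (-1) p.1 ∩ (halfPlane 0 \ ↑(box 2 m))) a :=
    (mem_siteCluster_self_iff _ _ _).2 ha.nonempty.some_mem.1
  obtain ⟨q, hq⟩ := exists_walk_of_mem_siteCluster haself (huq a b ha hb)
  set α := Wx.append (q.append Wy.reverse) with hα
  obtain ⟨H, hH⟩ := exists_box_of_list α.support
  have hU : UpperType m α :=
    upperType_append hm Wx q Wy (fun z hz => (hWx z hz).2)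
      (fun z hz => ⟨(hq z hz).2.1, fun h => (hq z hz).2.2 (Finset.mem_coe.2 h)⟩) (fun z hz => (hWy z hz).2) hy1
  refine ⟨H, α, hU, fun z hz => ⟨?_, hH z hz⟩⟩
  have hz1 : p.1 z = -1 := by
    rw [hα, Walk.mem_support_append_iff, Walk.mem_support_append_iff, Walk.support_reverse, List.mem_reverse] at hz
    rcases hz with hz | hz | hz
    · exact (hWx z hz).1
    · exact (hq z hz).1
    · exact (hWy z hz).1
  rw [mem_spinSites_badConfig]
  rintro ⟨h1, -⟩
  rw [hz1] at h1
  exact absurd h1 (by decide)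

end Det

/-! ### The probability bounds -/

section Prob

variable {β : ℝ} {μ₁ μ₂ : Measure (SpinConfig (Site 2))}

/-- From an almost sure inclusion into the union of the increasing events `A_{x,y}(H)`, a lower bound
for `A_{x,y}(H)` eventually. [folklore] -/
theorem exists_goodAboveW_eventually_ge (ν : Measure (SpinConfig (Site 2) × SpinConfig (Site 2))) [IsFiniteMeasure ν]
    (m : ℕ) (x y : Site 2) {E : Set (SpinConfig (Site 2) × SpinConfig (Site 2))} {c : ℝ} (hc : c ≤ ν.real E)
    (hincl : ∀ᵐ p ∂ν, p ∈ E → ∃ H, GoodAboveW m H x y p) {ε : ℝ} (hε : 0 < ε) :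
    ∃ H₀ : ℕ, ∀ H, H₀ ≤ H → c - ε ≤ ν.real {p | GoodAboveW m H x y p} := by
  set G : ℕ → Set (SpinConfig (Site 2) × SpinConfig (Site 2)) := fun H => {p | GoodAboveW m H x y p} with hG
  have hmono : Monotone G := by
    intro H H' hHH' p ⟨α, hU, hα⟩
    exact ⟨α, hU, fun z hz => ⟨(hα z hz).1, box_mono 2 hHH' (hα z hz).2⟩⟩
  have hlim : Tendsto (fun H => ν (G H)) atTop (𝓝 (ν (⋃ H, G H))) := tendsto_measure_iUnion_atTop hmono
  have hlim' : Tendsto (fun H => ν.real (G H)) atTop (𝓝 ((ν (⋃ H, G H)).toReal)) :=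
    (ENNReal.tendsto_toReal (measure_ne_top _ _)).comp hlim
  have hge : c ≤ (ν (⋃ H, G H)).toReal := by
    refine hc.trans ?_
    rw [measureReal_def]
    refine ENNReal.toReal_mono (measure_ne_top _ _) (measure_mono_ae ?_)
    filter_upwards [hincl] with p hp hpE
    obtain ⟨H, hH⟩ := hp hpE
    exact Set.mem_iUnion.2 ⟨H, hH⟩
  have hev := hlim'.eventually (Ioi_mem_nhds (show (ν (⋃ H, G H)).toReal - ε < (ν (⋃ H, G H)).toReal by linarith))
  obtain ⟨H₀, hH₀⟩ := eventually_atTop.1 hev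
  exact ⟨H₀, fun H hH => by
    have h' : (ν (⋃ H, G H)).toReal - ε < ν.real (G H) := hH₀ H hH
    linarith⟩

/-- **Case 1 bound**: for `β ≥ 0`, `μ₁ ∈ 𝒢(β, 0)` and a tail-trivial `μ₂ ∈ 𝒢(β, 0)` under which the
infinite `∗`-component of `S⁺ ∩ (π_up ∖ Λ_m)` is almost surely unique, an axis site `y` and any `x`:
`μ₂(PinLeft m x) μ₂(PinRightPlus m y) - ε ≤ (μ₁ ⊗ μ₂)(A_{x,y}(H))` for `H` large. [cite: GeorgiiHiguchi2000, Lemma 5.5 (proof, Case 1)] -/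
theorem le_measureReal_goodAboveW_of_pins_plus (hβ : 0 ≤ β) (hμ₁ : μ₁ ∈ isingGibbsMeasures 2 β 0)
    (hμ₂ : μ₂ ∈ isingGibbsMeasures 2 β 0) (hμ₂t : IsTailTrivial μ₂) {m : ℕ} (hm : 1 ≤ m)
    (huq : ∀ᵐ ω ∂μ₂, ∀ x₁ x₂, (siteCluster zdStarGraph (spinSites 1 ω ∩ (halfPlane 0 \ ↑(box 2 m))) x₁).Infinite →
      (siteCluster zdStarGraph (spinSites 1 ω ∩ (halfPlane 0 \ ↑(box 2 m))) x₂).Infinite →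
        x₂ ∈ siteCluster zdStarGraph (spinSites 1 ω ∩ (halfPlane 0 \ ↑(box 2 m))) x₁)
    (x y : Site 2) (hy1 : y 1 = 0) {cx cy : ℝ} (hcy : 0 ≤ cy)
    (hpx : cx ≤ μ₂.real {ω | PinLeft m x ω}) (hpy : cy ≤ μ₂.real {ω | PinRightPlus m y ω}) {ε : ℝ} (hε : 0 < ε) :
    ∃ H₀ : ℕ, ∀ H, H₀ ≤ H → cx * cy - ε ≤ (μ₁.prod μ₂).real {p | GoodAboveW m H x y p} := by
  classical
  have hμ₁G : IsGibbsMeasure (isingSpecification (zdGraph 2) β 0) μ₁ := hμ₁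
  have hμ₂G : IsGibbsMeasure (isingSpecification (zdGraph 2) β 0) μ₂ := hμ₂
  haveI := hμ₁G.isProbabilityMeasure
  haveI := hμ₂G.isProbabilityMeasure
  set D : Set (SpinConfig (Site 2)) := {ω | PinLeft m x ω} with hD
  set E : Set (SpinConfig (Site 2)) := {ω | PinRightPlus m y ω} with hE
  have hDm : MeasurableSet D := measurableSet_pinLeft (m := m) x
  have hEm : MeasurableSet E := measurableSet_pinRightPlus (m := m) y
  have hDup : IsUpperSet D := fun ω ω' hle hω => pinLeft_mono hle hω
  have hEup : IsUpperSet E := fun ω ω' hle hω => pinRightPlus_mono hle hω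
  have hfkg := measureReal_inter_ge_mul_of_isUpperSet hβ hμ₂ hμ₂t hDup hEup hDm hEm
  have hc : cx * cy ≤ (μ₁.prod μ₂).real (Set.univ ×ˢ (D ∩ E)) := by
    rw [measureReal_def, Measure.prod_prod, measure_univ, one_mul, ← measureReal_def]
    exact (mul_le_mul hpx hpy hcy measureReal_nonneg).trans hfkg
  refine exists_goodAboveW_eventually_ge _ m x y hc ?_ hε
  have hae := (Measure.quasiMeasurePreserving_snd (μ := μ₁) (ν := μ₂)).ae huq
  filter_upwards [hae] with p hp hpE
  simp only [Set.mem_prod, Set.mem_univ, true_and, Set.mem_inter_iff] at hpE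
  exact exists_goodAboveW_of_pins_plus hm hy1 hp hpE.1 hpE.2

/-- **Case 2 bound**: for `β ≥ 0`, a tail-trivial `μ₁ ∈ 𝒢(β, 0)` under which the infinite
`∗`-component of `S⁻ ∩ (π_up ∖ Λ_m)` is almost surely unique, `μ₂ ∈ 𝒢(β, 0)`, an axis site `y` and
any `x`: `μ₁(PinLeft m x (-·)) μ₁(PinRightMinus m y) - ε ≤ (μ₁ ⊗ μ₂)(A_{x,y}(H))` for `H` large. [cite: GeorgiiHiguchi2000, Lemma 5.5 (proof, Case 2)] -/
theorem le_measureReal_goodAboveW_of_pins_minus (hβ : 0 ≤ β) (hμ₁ : μ₁ ∈ isingGibbsMeasures 2 β 0)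
    (hμ₁t : IsTailTrivial μ₁) (hμ₂ : μ₂ ∈ isingGibbsMeasures 2 β 0) {m : ℕ} (hm : 1 ≤ m)
    (huq : ∀ᵐ ω ∂μ₁, ∀ x₁ x₂, (siteCluster zdStarGraph (spinSites (-1) ω ∩ (halfPlane 0 \ ↑(box 2 m))) x₁).Infinite →
      (siteCluster zdStarGraph (spinSites (-1) ω ∩ (halfPlane 0 \ ↑(box 2 m))) x₂).Infinite →
        x₂ ∈ siteCluster zdStarGraph (spinSites (-1) ω ∩ (halfPlane 0 \ ↑(box 2 m))) x₁)
    (x y : Site 2) (hy1 : y 1 = 0) {cx cy : ℝ} (hcy : 0 ≤ cy)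
    (hpx : cx ≤ μ₁.real {ω | PinLeft m x (-ω)}) (hpy : cy ≤ μ₁.real {ω | PinRightMinus m y ω}) {ε : ℝ} (hε : 0 < ε) :
    ∃ H₀ : ℕ, ∀ H, H₀ ≤ H → cx * cy - ε ≤ (μ₁.prod μ₂).real {p | GoodAboveW m H x y p} := by
  classical
  have hμ₁G : IsGibbsMeasure (isingSpecification (zdGraph 2) β 0) μ₁ := hμ₁
  have hμ₂G : IsGibbsMeasure (isingSpecification (zdGraph 2) β 0) μ₂ := hμ₂
  haveI := hμ₁G.isProbabilityMeasure
  haveI := hμ₂G.isProbabilityMeasure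
  set D : Set (SpinConfig (Site 2)) := {ω | PinLeft m x (-ω)} with hD
  set E : Set (SpinConfig (Site 2)) := {ω | PinRightMinus m y ω} with hE
  have hDm : MeasurableSet D := measurableSet_pinLeft_neg (m := m) x
  have hEm : MeasurableSet E := measurableSet_pinRightMinus (m := m) y
  have hDlow : IsLowerSet D := fun ω ω' hle hω => pinLeft_mono (fun z => units_neg_le_neg (hle z)) hω
  have hElow : IsLowerSet E := fun ω ω' hle hω => pinRightMinus_anti hle hω
  have hfkg := measureReal_inter_ge_mul_of_isLowerSet hβ hμ₁ hμ₁t hDlow hElow hDm hEm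
  have hc : cx * cy ≤ (μ₁.prod μ₂).real ((D ∩ E) ×ˢ Set.univ) := by
    rw [measureReal_def, Measure.prod_prod, measure_univ, mul_one, ← measureReal_def]
    exact (mul_le_mul hpx hpy hcy measureReal_nonneg).trans hfkg
  refine exists_goodAboveW_eventually_ge _ m x y hc ?_ hε
  have hae := (Measure.quasiMeasurePreserving_fst (μ := μ₁) (ν := μ₂)).ae huq
  filter_upwards [hae] with p hp hpE
  simp only [Set.mem_prod, Set.mem_univ, and_true, Set.mem_inter_iff] at hpE
  exact exists_goodAboveW_of_pins_minus hm hy1 hp hpE.1 hpE.2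

end Prob

end Literature.Probability.LatticeModels
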